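import Literature.NumberTheory.EllipticCurves.ManinConstantGamma1ModularDegree
import Literature.NumberTheory.EllipticCurves.ModularSymbolsProofs
import HarnessLib

/-!
# THEOREM B (es g18, MEMO-es §31.17; T-es-23): the `Γ₁(N)`-period lattice `Λ₁(f)` is generated by the BALANCED CUSP
# DIFFERENCES `{∞, b/m}_f − {∞, b′/m}_f` at conductors `m ≡ ±1 (mod N)` — PROVED (cell `bsd-f2-manin`, typer g13)

`periodLatticeGamma1 f = AddSubgroup.closure (balancedCuspDiffs f)` for every `f ∈ S₂(Γ₀(N))`, `N ≥ 2`
(`periodLatticeGamma1_eq_closure_balancedCuspDiffs`).  Elementary: Manin's relation at `r = 0` (LEMMA A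
`exists_gamma0_modularSymbol_div`: `{∞, b/m} = {∞, δ∞} + {∞, 0}` for `δ = (v b; −uN m) ∈ Γ₀(N)`), the ZERO-CYCLE LEMMA
`exists_modularSymbol_div_eq_zero` (`{∞, b₀/m} = {∞, 0}` for `b₀N ≡ −ε (mod m)`, `m ≡ ε = ±1 (mod N)`: the matrix
`ε·(1 0; εN 1)(1 −k; 0 1)` is ± a product of two parabolics), `cuspSymbol_gamma1_mem_closure` (every `Γ₁(N)`-period is a
balanced difference) and `balancedCuspDiffs_subset` (every balanced difference is a `Γ₁(N)`-period).  Consequence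
(MEMO-es §31.11/§31.17): the census statements BAL⋆ / AVG⋆ are theorems.  SOURCE: HOME/es/Sketch-es-g18-bal.lean
00ba62a68f72b567 §4e (= Sketch-es-g18.lean ef55fface19232db §4e), VERBATIM up to the namespace
(`BsdF2ManinEsG18` ↦ `…ManinAdditive.Gamma1Lattice`); es farm rc 0 · 0 sorries; REF1 §R67 (R-es-37 (a),
HOME/ref1/R67-ref1-es-g18.md 3182991c71e18394): **THEOREM B/B′ PROVED — 12/12 closures standard, zero-cycle lemma
re-derived; port GO**.  The prime-conductor refinement B′ is the sibling `Gamma1LatticeBalancedCuspDifferencesPrime`;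
the degeneracy-loop law E-es-68 (which uses LEMMA A) is the sibling `DegeneracyLoopLaws`.  Nothing about BSD or any
Manin constant is asserted.  PARTITION 0 · beyond-print theorem: no (new sorry-free lemmas of known type, Manin 1972
Thm 1.9 level) · BSD is not proved by this.
-/

set_option autoImplicit false

noncomputable section

open scoped MatrixGroups ModularForm

open CongruenceSubgroup Literature.NumberTheory.EllipticCurves
  Literature.NumberTheory.EllipticCurves.ModularForms

namespace Summit.BirchSwinnertonDyer.Rank1Residual.ManinAdditive.Gamma1Lattice

variable {N : ℕ} [NeZero N] (f : CuspForm (Gamma0 N) 2)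

/-- The set of **balanced cusp differences at conductors `≡ ±1 (mod N)`**:
`{∞, b/m}_f − {∞, b'/m}_f` with `m ≠ 0`, `m ≡ ±1 (mod N)`, `gcd(b, m) = gcd(b', m) = 1`. -/
def balancedCuspDiffs : Set ℂ :=
  {z | ∃ (m b b' : ℤ), m ≠ 0 ∧ ((m : ZMod N) = 1 ∨ (m : ZMod N) = -1) ∧ IsCoprime b m ∧
      IsCoprime b' m ∧ z = modularSymbol f ((b : ℚ) / m) - modularSymbol f ((b' : ℚ) / m)}

omit [NeZero N] in
/-- `m ≡ ±1 (mod N)` gives `gcd(N, m) = 1`. -/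
theorem isCoprime_of_pm_one {m : ℤ} (hm : (m : ZMod N) = 1 ∨ (m : ZMod N) = -1) :
    IsCoprime (N : ℤ) m := by
  rcases hm with h | h
  · have h0 : ((m - 1 : ℤ) : ZMod N) = 0 := by push_cast; rw [h, sub_self]
    obtain ⟨k, hk⟩ := (ZMod.intCast_zmod_eq_zero_iff_dvd _ N).mp h0
    exact ⟨-k, 1, by linarith⟩
  · have h0 : ((m + 1 : ℤ) : ZMod N) = 0 := by push_cast; rw [h, neg_add_cancel]
    obtain ⟨k, hk⟩ := (ZMod.intCast_zmod_eq_zero_iff_dvd _ N).mp h0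
    exact ⟨k, -1, by linarith⟩

/-- **Lemma A.** For `gcd(b, m) = gcd(N, m) = 1`, `m ≠ 0`, there is `δ = (v b; -uN m) ∈ Γ₀(N)` with
`δ 0 = b/m`, so `{∞, b/m} = {∞, δ∞} + {∞, 0}` (Manin relation at `r = 0`). -/
theorem exists_gamma0_modularSymbol_div {b m : ℤ} (hm : m ≠ 0) (hb : IsCoprime b m)
    (hN : IsCoprime (N : ℤ) m) :
    ∃ δ : Gamma0 N, ((δ : SL(2, ℤ)) 1 1 : ℤ) = m ∧ ((δ : SL(2, ℤ)) 0 1 : ℤ) = b ∧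
      modularSymbol f ((b : ℚ) / m) = cuspSymbol f δ + modularSymbol f 0 := by
  obtain ⟨u, v, huv⟩ := hb.mul_left hN   -- u * (b * N) ... careful: (b * N) coprime m
  -- huv : u * (b * ↑N) + v * m = 1
  let M : SL(2, ℤ) := ⟨!![v, b; -(u * N), m], by rw [Matrix.det_fin_two_of]; linarith⟩
  have hM0 : M ∈ Gamma0 N := by
    rw [Gamma0_mem]
    show (((-(u * (N : ℤ))) : ℤ) : ZMod N) = 0
    push_cast
    simp
  refine ⟨⟨M, hM0⟩, rfl, rfl, ?_⟩
  have hmQ : (m : ℚ) ≠ 0 := by exact_mod_cast hm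
  have e00 : (((⟨M, hM0⟩ : Gamma0 N) : SL(2, ℤ)) 0 0 : ℤ) = v := rfl
  have e01 : (((⟨M, hM0⟩ : Gamma0 N) : SL(2, ℤ)) 0 1 : ℤ) = b := rfl
  have e10 : (((⟨M, hM0⟩ : Gamma0 N) : SL(2, ℤ)) 1 0 : ℤ) = -(u * N) := rfl
  have e11 : (((⟨M, hM0⟩ : Gamma0 N) : SL(2, ℤ)) 1 1 : ℤ) = m := rfl
  have hne : ((((⟨M, hM0⟩ : Gamma0 N) : SL(2, ℤ)) 1 0 : ℤ) : ℚ) * (0 : ℚ) +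
      ((((⟨M, hM0⟩ : Gamma0 N) : SL(2, ℤ)) 1 1 : ℤ) : ℚ) ≠ 0 := by
    rw [e10, e11]; simpa using hmQ
  have key := modularSymbol_gamma0_smul_holds f ⟨M, hM0⟩ 0 hne
  rw [e00, e01, e10, e11] at key
  simpa only [mul_zero, zero_add] using key

/-- **Zero-cycle lemma.** For `m ≡ ±1 (mod N)`, `m ≠ 0`, there is `b₀` prime to `m` with
`{∞, b₀/m}_f = {∞, 0}_f`: with `uN + vm = 1`, `γ = (v -u; N m) ∈ Γ₀(N)` maps the integer
`k = (±1 - m)/N` to an integer, so `{∞, γ∞} = 0` and `{∞, -u/m} = {∞, γ 0} = {∞, 0}`. -/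
theorem exists_modularSymbol_div_eq_zero {m : ℤ} (hm : m ≠ 0)
    (hpm : (m : ZMod N) = 1 ∨ (m : ZMod N) = -1) :
    ∃ b₀ : ℤ, IsCoprime b₀ m ∧ modularSymbol f ((b₀ : ℚ) / m) = modularSymbol f 0 := by
  obtain ⟨u, v, huv⟩ := isCoprime_of_pm_one hpm   -- u * N + v * m = 1
  let M : SL(2, ℤ) := ⟨!![v, -u; (N : ℤ), m], by rw [Matrix.det_fin_two_of]; linarith⟩
  have hM0 : M ∈ Gamma0 N := by
    rw [Gamma0_mem]
    show (((N : ℤ)) : ZMod N) = 0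
    simp
  -- an integer `k` and a sign `ε = ±1` with `N k + m = ε`
  obtain ⟨k, ε, hε, hk⟩ : ∃ k ε : ℤ, (ε = 1 ∨ ε = -1) ∧ (N : ℤ) * k + m = ε := by
    rcases hpm with h | h
    · have h0 : ((m - 1 : ℤ) : ZMod N) = 0 := by push_cast; rw [h, sub_self]
      obtain ⟨k, hk⟩ := (ZMod.intCast_zmod_eq_zero_iff_dvd _ N).mp h0
      exact ⟨-k, 1, Or.inl rfl, by linarith⟩
    · have h0 : ((m + 1 : ℤ) : ZMod N) = 0 := by push_cast; rw [h, neg_add_cancel]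
      obtain ⟨k, hk⟩ := (ZMod.intCast_zmod_eq_zero_iff_dvd _ N).mp h0
      exact ⟨-k, -1, Or.inr rfl, by linarith⟩
  have hεQ : (ε : ℚ) ≠ 0 := by rcases hε with rfl | rfl <;> norm_num
  have hmQ : (m : ℚ) ≠ 0 := by exact_mod_cast hm
  have hadd := modularSymbol_add_intCast_holds f
  have hint : ∀ n : ℤ, modularSymbol f (n : ℚ) = modularSymbol f 0 := by
    intro n; have := hadd 0 n; rwa [zero_add] at this
  have e00 : (((⟨M, hM0⟩ : Gamma0 N) : SL(2, ℤ)) 0 0 : ℤ) = v := rfl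
  have e01 : (((⟨M, hM0⟩ : Gamma0 N) : SL(2, ℤ)) 0 1 : ℤ) = -u := rfl
  have e10 : (((⟨M, hM0⟩ : Gamma0 N) : SL(2, ℤ)) 1 0 : ℤ) = N := rfl
  have e11 : (((⟨M, hM0⟩ : Gamma0 N) : SL(2, ℤ)) 1 1 : ℤ) = m := rfl
  have hden : (((N : ℤ) : ℤ) : ℚ) * (k : ℚ) + ((m : ℤ) : ℚ) = (ε : ℚ) := by exact_mod_cast hk
  -- Manin relation at `r = k`: `γ k = ε (v k - u)`, an integer
  have hne₁ : ((((⟨M, hM0⟩ : Gamma0 N) : SL(2, ℤ)) 1 0 : ℤ) : ℚ) * (k : ℚ) +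
      ((((⟨M, hM0⟩ : Gamma0 N) : SL(2, ℤ)) 1 1 : ℤ) : ℚ) ≠ 0 := by
    rw [e10, e11, hden]; exact hεQ
  have key₁ := modularSymbol_gamma0_smul_holds f ⟨M, hM0⟩ (k : ℚ) hne₁
  rw [e00, e01, e10, e11, hden] at key₁
  have e₁ : (((v : ℤ) : ℚ) * (k : ℚ) + ((-u : ℤ) : ℚ)) / (ε : ℚ) = ((ε * (v * k - u) : ℤ) : ℚ) := by
    rw [div_eq_iff hεQ]
    have hε2 : (ε : ℚ) * ε = 1 := by rcases hε with rfl | rfl <;> norm_num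
    push_cast
    linear_combination (u - v * k : ℚ) * hε2
  rw [e₁, hint, hint] at key₁
  -- hence `{∞, γ∞} = 0`
  have hcusp : cuspSymbol f ⟨M, hM0⟩ = 0 := by
    calc cuspSymbol f ⟨M, hM0⟩
        = (cuspSymbol f ⟨M, hM0⟩ + modularSymbol f 0) - modularSymbol f 0 := by ring
      _ = 0 := by rw [← key₁, sub_self]
  -- Manin relation at `r = 0`: `{∞, -u/m} = {∞, γ∞} + {∞, 0} = {∞, 0}`
  have hne₀ : ((((⟨M, hM0⟩ : Gamma0 N) : SL(2, ℤ)) 1 0 : ℤ) : ℚ) * (0 : ℚ) +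
      ((((⟨M, hM0⟩ : Gamma0 N) : SL(2, ℤ)) 1 1 : ℤ) : ℚ) ≠ 0 := by
    rw [e10, e11]; simpa using hmQ
  have key₀ := modularSymbol_gamma0_smul_holds f ⟨M, hM0⟩ 0 hne₀
  rw [e00, e01, e10, e11, hcusp, zero_add] at key₀
  simp only [mul_zero, zero_add] at key₀
  refine ⟨-u, ?_, key₀⟩
  exact (show IsCoprime u m from ⟨(N : ℤ), v, by linarith⟩).neg_left

omit [NeZero N] in
/-- `{∞, (-δ)∞} = {∞, δ∞}`: the cusp `a/c = (-a)/(-c)`. -/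
theorem cuspSymbol_neg (δ : Gamma0 N) (h : (-(δ : SL(2, ℤ))) ∈ Gamma0 N) :
    cuspSymbol f ⟨-(δ : SL(2, ℤ)), h⟩ = cuspSymbol f δ := by
  unfold cuspSymbol
  have e10 : ((⟨-(δ : SL(2, ℤ)), h⟩ : Gamma0 N) : SL(2, ℤ)) 1 0 = -((δ : SL(2, ℤ)) 1 0) := by
    simp [Matrix.SpecialLinearGroup.coe_neg]
  have e00 : ((⟨-(δ : SL(2, ℤ)), h⟩ : Gamma0 N) : SL(2, ℤ)) 0 0 = -((δ : SL(2, ℤ)) 0 0) := by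
    simp [Matrix.SpecialLinearGroup.coe_neg]
  rw [e10, e00]
  simp only [neg_eq_zero]
  split_ifs with hc
  · rfl
  · push_cast
    rw [neg_div_neg_eq]

/-- **(⊆)** every generator `{∞, δ∞}`, `δ ∈ Γ₁(N)`, is a balanced cusp difference (for `N ≥ 2`). -/
theorem cuspSymbol_gamma1_mem_closure (hN : 2 ≤ N) (γ : Gamma1 N) :
    cuspSymbol f ⟨(γ : SL(2, ℤ)), Gamma1_in_Gamma0 N γ.2⟩ ∈
      AddSubgroup.closure (balancedCuspDiffs f) := by
  set δ : SL(2, ℤ) := (γ : SL(2, ℤ)) with hδdef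
  have hγ1 := (Gamma1_mem N δ).mp γ.2
  by_cases hC : (δ 1 0 : ℤ) = 0
  · have : cuspSymbol f ⟨δ, Gamma1_in_Gamma0 N γ.2⟩ = 0 := by
      unfold cuspSymbol; simp [hC]
    rw [this]; exact zero_mem _
  -- `d ≠ 0` since `d ≡ 1 (mod N)` and `N ≥ 2`
  have hd : (δ 1 1 : ℤ) ≠ 0 := by
    intro h0
    have h1 := hγ1.2.1
    rw [h0, Int.cast_zero] at h1
    haveI : Fact (1 < N) := ⟨hN⟩
    exact zero_ne_one h1
  have hdQ : ((δ 1 1 : ℤ) : ℚ) ≠ 0 := by exact_mod_cast hd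
  -- Manin relation at `r = 0`: `{∞, b/d} = {∞, δ∞} + {∞, 0}`
  have hne : ((δ 1 0 : ℤ) : ℚ) * (0 : ℚ) + ((δ 1 1 : ℤ) : ℚ) ≠ 0 := by simpa using hdQ
  have key := modularSymbol_gamma0_smul_holds f ⟨δ, Gamma1_in_Gamma0 N γ.2⟩ 0 hne
  have e : (((δ 0 0 : ℤ) : ℚ) * 0 + ((δ 0 1 : ℤ) : ℚ)) / (((δ 1 0 : ℤ) : ℚ) * 0 + ((δ 1 1 : ℤ) : ℚ))
      = ((δ 0 1 : ℤ) : ℚ) / ((δ 1 1 : ℤ) : ℚ) := by simp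
  rw [e] at key
  -- the zero cycle at conductor `d`
  obtain ⟨b₀, hb₀, hz⟩ := exists_modularSymbol_div_eq_zero f hd (Or.inl hγ1.2.1)
  have hdet : (δ 0 0 : ℤ) * (δ 1 1 : ℤ) - (δ 0 1 : ℤ) * (δ 1 0 : ℤ) = 1 := by
    have := Matrix.det_fin_two (δ : Matrix (Fin 2) (Fin 2) ℤ)
    rw [δ.2] at this
    exact this.symm
  have hb : IsCoprime (δ 0 1 : ℤ) (δ 1 1 : ℤ) := ⟨-(δ 1 0 : ℤ), (δ 0 0 : ℤ), by linarith⟩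
  have hmem : modularSymbol f (((δ 0 1 : ℤ) : ℚ) / ((δ 1 1 : ℤ) : ℚ)) -
      modularSymbol f ((b₀ : ℚ) / ((δ 1 1 : ℤ) : ℚ)) ∈ balancedCuspDiffs f :=
    ⟨(δ 1 1 : ℤ), (δ 0 1 : ℤ), b₀, hd, Or.inl hγ1.2.1, hb, hb₀, rfl⟩
  have : cuspSymbol f ⟨δ, Gamma1_in_Gamma0 N γ.2⟩ =
      modularSymbol f (((δ 0 1 : ℤ) : ℚ) / ((δ 1 1 : ℤ) : ℚ)) -
        modularSymbol f ((b₀ : ℚ) / ((δ 1 1 : ℤ) : ℚ)) := by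
    rw [hz, key]; ring
  rw [this]
  exact AddSubgroup.subset_closure hmem

/-- **(⊇)** every balanced cusp difference at a conductor `≡ ±1 (mod N)` is a `Γ₁(N)`-period. -/
theorem balancedCuspDiffs_subset : balancedCuspDiffs f ⊆ (periodLatticeGamma1 f : Set ℂ) := by
  rintro z ⟨m, b, b', hm, hpm, hb, hb', rfl⟩
  have hNm := isCoprime_of_pm_one hpm
  -- a `Γ₀(N)`-matrix `δ` with `δ 0 = b/m`, lower-right entry `m`; it lies in `±Γ₁(N)`
  have hper : ∀ {b : ℤ}, IsCoprime b m →
      modularSymbol f ((b : ℚ) / m) - modularSymbol f 0 ∈ periodLatticeGamma1 f := by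
    intro b hb
    obtain ⟨δ, hδm, hδb, hδ⟩ := exists_gamma0_modularSymbol_div f hm hb hNm
    rw [hδ, add_sub_cancel_right]
    have hdet : ((δ : SL(2, ℤ)) 0 0 : ℤ) * ((δ : SL(2, ℤ)) 1 1 : ℤ) -
        ((δ : SL(2, ℤ)) 0 1 : ℤ) * ((δ : SL(2, ℤ)) 1 0 : ℤ) = 1 := by
      have := Matrix.det_fin_two ((δ : SL(2, ℤ)) : Matrix (Fin 2) (Fin 2) ℤ)
      rw [(δ : SL(2, ℤ)).2] at this
      exact this.symm
    have h10 : (((δ : SL(2, ℤ)) 1 0 : ℤ) : ZMod N) = 0 := Gamma0_mem.mp δ.2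
    have hdetZ : (((δ : SL(2, ℤ)) 0 0 : ℤ) : ZMod N) * (m : ZMod N) = 1 := by
      have := congrArg (fun x : ℤ => (x : ZMod N)) hdet
      simp only [Int.cast_sub, Int.cast_mul, Int.cast_one, h10, mul_zero, sub_zero, hδm] at this
      exact this
    rcases hpm with h1 | h1
    · -- `δ ∈ Γ₁(N)`
      have hG1 : (δ : SL(2, ℤ)) ∈ Gamma1 N := by
        rw [Gamma1_mem]
        refine ⟨?_, by rw [hδm, h1], h10⟩
        rw [h1, mul_one] at hdetZ; exact hdetZ
      exact cuspSymbol_mem_periodLatticeGamma1 f ⟨(δ : SL(2, ℤ)), hG1⟩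
    · -- `-δ ∈ Γ₁(N)` and `{∞, (-δ)∞} = {∞, δ∞}`
      have hG1 : (-(δ : SL(2, ℤ))) ∈ Gamma1 N := by
        rw [Gamma1_mem]
        have e00 : ((-(δ : SL(2, ℤ))) 0 0 : ℤ) = -((δ : SL(2, ℤ)) 0 0) := by
          simp [Matrix.SpecialLinearGroup.coe_neg]
        have e11 : ((-(δ : SL(2, ℤ))) 1 1 : ℤ) = -((δ : SL(2, ℤ)) 1 1) := by
          simp [Matrix.SpecialLinearGroup.coe_neg]
        have e10 : ((-(δ : SL(2, ℤ))) 1 0 : ℤ) = -((δ : SL(2, ℤ)) 1 0) := by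
          simp [Matrix.SpecialLinearGroup.coe_neg]
        rw [e00, e11, e10]
        push_cast
        refine ⟨?_, by rw [hδm, h1, neg_neg], by rw [h10, neg_zero]⟩
        rw [h1, mul_neg, mul_one] at hdetZ
        exact hdetZ
      have hG0 : (-(δ : SL(2, ℤ))) ∈ Gamma0 N := Gamma1_in_Gamma0 N hG1
      have := cuspSymbol_mem_periodLatticeGamma1 f ⟨-(δ : SL(2, ℤ)), hG1⟩
      rwa [show (⟨((⟨-(δ : SL(2, ℤ)), hG1⟩ : Gamma1 N) : SL(2, ℤ)), Gamma1_in_Gamma0 N hG1⟩ : Gamma0 N)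
          = ⟨-(δ : SL(2, ℤ)), hG0⟩ from rfl, cuspSymbol_neg f δ hG0] at this
  have e : modularSymbol f ((b : ℚ) / m) - modularSymbol f ((b' : ℚ) / m) =
      (modularSymbol f ((b : ℚ) / m) - modularSymbol f 0) -
        (modularSymbol f ((b' : ℚ) / m) - modularSymbol f 0) := by ring
  rw [e]
  exact sub_mem (hper hb) (hper hb')

/-- **THEOREM B (balanced generation of `Λ₁`).** For `N ≥ 2` and every `f ∈ S₂(Γ₀(N))`, the
`Γ₁(N)`-period lattice `Λ₁(f)` is the subgroup of `ℂ` generated by the balanced cusp differences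
`{∞, b/m}_f − {∞, b'/m}_f` at conductors `m ≡ ±1 (mod N)` (`gcd(b, m) = gcd(b', m) = 1`). -/
theorem periodLatticeGamma1_eq_closure_balancedCuspDiffs (hN : 2 ≤ N) :
    periodLatticeGamma1 f = AddSubgroup.closure (balancedCuspDiffs f) := by
  refine le_antisymm ?_ ((AddSubgroup.closure_le _).mpr (balancedCuspDiffs_subset f))
  unfold periodLatticeGamma1
  refine (AddSubgroup.closure_le _).mpr ?_
  rintro _ ⟨γ, rfl⟩
  exact cuspSymbol_gamma1_mem_closure f hN γ


end Summit.BirchSwinnertonDyer.Rank1Residual.ManinAdditive.Gamma1Lattice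

end
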